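import Summits.QuantumFields.QCD.Theses.SmallBetaInfraredSplit
import Literature.MathematicalPhysics.StatisticalMechanics.GradedKernelChiralLRO
import Literature.Probability.LatticeModels.LatticeGreenRiemannSum

/-!
# Route `SmallBetaInfraredSplit` (sub QCD) — support item `FourierSumRule` (S1), PROVED

The kernel-abstract torus Fourier sum rule behind Salmhofer–Seiler (4.40): on the even torus
`Λ = (ℤ/Lℤ)^ν` (`ν ≥ 1`, `L ≥ 4` even), for every symmetric, translation-invariant real kernel
`K` which is parity-graded (`K(x,y) = 0` when `ε(x) = ε(y)`), an infrared bound
`∑_{x,y} h(x) (−Δh)(y) K(x,y) ≤ B ‖h‖²` for all real `h` implies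
`|Λ|⁻¹ ∑_x ∑_μ (K(x,x+e_μ) + K(x,x−e_μ)) ≤ 4ν · |Λ|⁻¹ ∑_x K(0,x) + 2B · S_Λ(ν)`,
`S_Λ(ν) = |Λ|⁻¹ ∑_{k ≠ 0, C(k)>0} C(k)/(ν − C(k))` the lattice sum of (4.3).

Proof (finite Fourier analysis on the characters `χ` of the torus, on top of the tree's
`InfraredBoundSpectralStep` and `GradedKernelChiralLRO`):
* mode by mode, testing the infrared bound on `Re χ` and `Im χ` and using Parseval,
  `2(ν − C(χ)) ĝ(χ) ≤ B` for the (real) symbol `ĝ(χ) = ∑_z K(0,z) χ(z)` (`mode_le`);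
* the grading gives `ĝ(ε + χ) = −ĝ(χ)` for the staggered character `ε`
  (`kernelSymbol_stagChar_add`), hence the second half `−2(ν + C(χ)) ĝ(χ) ≤ B` of the mode-wise
  infrared bound — so a SINGLE infrared bound suffices for a graded kernel;
* the tree's kernel-abstract (4.40) `ComplexSpin.sum_kernel_nbr_le` (Fourier inversion of the
  nearest-neighbour sum, folding `k ↦ k + π̂` of the modes with `C < 0`, `sum_modeTerm_eq`) then gives
  `∑_μ (K(0,e_μ) + K(0,−e_μ)) ≤ (2ν/|Λ|)(ĝ(0) − ĝ(π̂)) + 2B·S_Λ(ν)` with `ĝ(π̂) = −ĝ(0) = −∑_x K(0,x)`.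

This is glue of LINE 6 (ideator `ym-idea-2` g4) onto the LADDER-YM rung Q1 leaf
`SalmhoferSeilerSmallBeta` (label RECORD, QCD side); the content is the `β`-independent part of
the 1991 proof of Thm. 4.8.  Nothing about long-range order at `β > 0`, a mass gap, a continuum
limit, or any summit is proved here.
[cite: SalmhoferSeiler1991, (3.104)–(3.113), (4.12)–(4.14), (4.40); FrohlichSimonSpencer1976]
-/

set_option autoImplicit false

namespace Summit.QuantumFields.QCD.Theorems.SmallBetaInfraredSplit

open Finset
open Literature.MathematicalPhysics.StatisticalMechanics
open Literature.MathematicalPhysics.StatisticalMechanics.ComplexSpin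
open Literature.Probability.LatticeModels (TorusSite)

section Fourier

variable {ν L : ℕ} [NeZero L]

/-- The quadratic form of the infrared bound, complexified: for a real kernel `K` and a complex
configuration `φ`, `Re ∑_x conj φ(x) (K·(−Δφ))(x) = Q(Re φ) + Q(Im φ)` with
`Q(h) = ∑_{x,y} h(x)(−Δh)(y)K(x,y)`. [cite: FrohlichSimonSpencer1976, §3] -/
theorem re_form_eq (K : TorusSite ν L → TorusSite ν L → ℝ) (φ : TorusSite ν L → ℂ) :
    (∑ x, starRingEnd ℂ (φ x) * kernelOp K (stencilC (-1) φ) x).re =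
      (∑ x, ∑ y, (φ x).re * (-laplacian (fun z => (φ z).re) y) * K x y) +
        ∑ x, ∑ y, (φ x).im * (-laplacian (fun z => (φ z).im) y) * K x y := by
  rw [Complex.re_sum, ← Finset.sum_add_distrib]
  refine Finset.sum_congr rfl fun x _ => ?_
  rw [kernelOp, Finset.mul_sum, Complex.re_sum, ← Finset.sum_add_distrib]
  refine Finset.sum_congr rfl fun y _ => ?_
  rw [← stencil_neg_one, ← stencil_neg_one, ← stencilC_re, ← stencilC_im]
  simp only [Complex.mul_re, Complex.mul_im, Complex.conj_re, Complex.conj_im, Complex.ofReal_re,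
    Complex.ofReal_im]
  ring

/-- **The infrared bound mode by mode**: for a symmetric translation-invariant real kernel `K`
with `∑_{x,y} h(x)(−Δh)(y)K(x,y) ≤ B‖h‖²` for all real `h`, the symbol satisfies
`2(ν − C(χ)) ĝ(χ) ≤ B` at every character `χ` (test on `Re χ`, `Im χ`; Parseval).
[cite: SalmhoferSeiler1991, (3.110)–(3.113)] -/
theorem mode_le {K : TorusSite ν L → TorusSite ν L → ℝ}
    (hS : ∀ x y, K x y = K y x) (hT : ∀ x y a, K (x + a) (y + a) = K x y) {B : ℝ}
    (hIR : ∀ h : TorusSite ν L → ℝ,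
      ∑ x, ∑ y, h x * (-laplacian h y) * K x y ≤ B * normSq h)
    (χ : AddChar (TorusSite ν L) ℂ) :
    2 * ((ν : ℝ) - cosSum χ) * (kernelSymbol K χ).re ≤ B := by
  classical
  have hn0 : (0 : ℝ) < Fintype.card (TorusSite ν L) := Nat.cast_pos.2 Fintype.card_pos
  have hreal : kernelSymbol K χ = (((kernelSymbol K χ).re : ℝ) : ℂ) :=
    (Complex.conj_eq_iff_re.1 (conj_kernelSymbol hT hS χ)).symm
  -- the quadratic form on `χ`, bounded by the hypothesis on `Re χ` and `Im χ`
  have hform : (∑ x, starRingEnd ℂ (χ x) * kernelOp K (stencilC (-1) ⇑χ) x).re ≤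
      B * Fintype.card (TorusSite ν L) := by
    rw [re_form_eq]
    have h1 := hIR fun z => (χ z).re
    have h2 := hIR fun z => (χ z).im
    have hnorm : normSq (fun z => (χ z).re) + normSq (fun z => (χ z).im) =
        Fintype.card (TorusSite ν L) := by
      unfold normSq
      rw [← Finset.sum_add_distrib]
      have : ∀ z : TorusSite ν L, (χ z).re ^ 2 + (χ z).im ^ 2 = 1 := fun z => by
        have h := Complex.sq_norm (χ z)
        rw [AddChar.norm_apply, Complex.normSq_apply] at h
        nlinarith [h]
      simp_rw [this]
      simp
    calc _ ≤ B * normSq (fun z => (χ z).re) + B * normSq (fun z => (χ z).im) := add_le_add h1 h2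
      _ = B * Fintype.card (TorusSite ν L) := by rw [← mul_add, hnorm]
  -- the same form through Parseval: `|Λ| · E(χ) ĝ(χ)`
  have hsingle : ∀ g : AddChar (TorusSite ν L) ℂ → ℂ,
      ∑ χ' : AddChar (TorusSite ν L) ℂ, starRingEnd ℂ (fcoeff (⇑χ) χ') * (g χ' * fcoeff (⇑χ) χ') =
        starRingEnd ℂ (Fintype.card (TorusSite ν L) : ℂ) *
          (g χ * (Fintype.card (TorusSite ν L) : ℂ)) := by
    intro g
    rw [Finset.sum_eq_single χ (fun χ' _ hne => by rw [fcoeff_addChar, if_neg hne]; simp)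
      (fun h => absurd (Finset.mem_univ χ) h), fcoeff_addChar, if_pos rfl]
  have hLHS : ∑ x, starRingEnd ℂ (χ x) * kernelOp K (stencilC (-1) ⇑χ) x =
      (Fintype.card (TorusSite ν L) : ℂ) * (symbol (-1) χ * kernelSymbol K χ) := by
    have hn : (Fintype.card (TorusSite ν L) : ℂ) ≠ 0 := Nat.cast_ne_zero.2 Fintype.card_ne_zero
    rw [parseval]
    simp_rw [fcoeff_kernelOp hT hS, fcoeff_stencilC]
    have : ∀ χ' : AddChar (TorusSite ν L) ℂ,
        starRingEnd ℂ (fcoeff (⇑χ) χ') * (kernelSymbol K χ' * (symbol (-1) χ' * fcoeff (⇑χ) χ')) =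
        starRingEnd ℂ (fcoeff (⇑χ) χ') *
          ((kernelSymbol K χ' * symbol (-1) χ') * fcoeff (⇑χ) χ') := by
      intro χ'; ring
    simp_rw [this]
    rw [hsingle, map_natCast]
    field_simp
  rw [hLHS, symbol_eq, hreal, symbolRe_neg_one] at hform
  simp only [← Complex.ofReal_natCast, ← Complex.ofReal_mul, Complex.ofReal_re] at hform
  -- `n · (2D ĝ) ≤ B · n`
  have : (Fintype.card (TorusSite ν L) : ℝ) * (2 * ((ν : ℝ) - cosSum χ) * (kernelSymbol K χ).re) ≤
      (Fintype.card (TorusSite ν L) : ℝ) * B := by linarith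
  exact le_of_mul_le_mul_left this hn0

/-- **The chiral grading on the dual torus**: for a parity-graded kernel (`K(x,y) = 0` when
`ε(x) = ε(y)`), `ĝ(ε + χ) = −ĝ(χ)` (`T̂(k + π̂) = −T̂(k)`, (3.106)).
[cite: SalmhoferSeiler1991, (3.101) and (3.106)] -/
theorem kernelSymbol_stagChar_add (hL : 2 ∣ L) {K : TorusSite ν L → TorusSite ν L → ℝ}
    (hpar : ∀ x y : TorusSite ν L, sgn hL x = sgn hL y → K x y = 0)
    (χ : AddChar (TorusSite ν L) ℂ) :
    kernelSymbol K (stagChar hL + χ) = -kernelSymbol K χ := by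
  unfold kernelSymbol
  rw [← Finset.sum_neg_distrib]
  refine Finset.sum_congr rfl fun z _ => ?_
  rw [AddChar.add_apply, stagChar_apply]
  by_cases hz : parity hL z = 0
  · have hK : K 0 z = 0 := hpar 0 z (by rw [sgn_zero]; unfold sgn; rw [if_pos hz])
    simp [hK]
  · rw [if_neg hz]
    ring

end Fourier

/-- The route's support item `FourierSumRule` BY NAME: the kernel-abstract torus Fourier sum rule
(4.40). [cite: SalmhoferSeiler1991, (4.40) with (4.14)] -/
theorem fourierSumRule_proof :
    Summit.QuantumFields.QCD.Theses.SmallBetaInfraredSplit.FourierSumRule := by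
  intro ν hν L _ hL hL4 K hS hT hpar B hIR
  have hT' : ∀ x y a : TorusSite ν L, K (x + a) (y + a) = K x y := fun x y a => hT a x y
  have hE : Even L := even_iff_two_dvd.mpr hL
  -- the mode-wise infrared bound, both halves (the second by the chiral grading)
  have hmodes : ∀ χ : AddChar (TorusSite ν L) ℂ, χ ≠ 0 → χ ≠ stagChar hE.two_dvd →
      2 * ((ν : ℝ) - cosSum χ) * (kernelSymbol K χ).re ≤ B ∧
        2 * ((ν : ℝ) + cosSum χ) * (-(kernelSymbol K χ).re) ≤ B := by
    intro χ _ _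
    refine ⟨mode_le hS hT' hIR χ, ?_⟩
    have h2 := mode_le hS hT' hIR (stagChar hL + χ)
    rw [cosSum_stagChar_add, kernelSymbol_stagChar_add hL hpar, Complex.neg_re, sub_neg_eq_add] at h2
    exact h2
  -- the grading at the origin: `K(0,z) = 0` on even sites
  have hgr : ∀ z : TorusSite ν L, parity hL z = 0 → K 0 z = 0 := fun z hz =>
    hpar 0 z (by rw [sgn_zero]; unfold sgn; rw [if_pos hz])
  have h := sum_kernel_nbr_le hν hE hT' hS hmodes
  rw [kernelSymbol_stagChar_re_of_graded hL hgr, kernelSymbol_zero_re] at h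
  -- translation invariance: the nearest-neighbour sum is `|Λ|` times the one at the origin
  have hnn : ∀ x : TorusSite ν L, ∑ μ : Fin ν, (K x (x + Pi.single μ 1) + K x (x - Pi.single μ 1)) =
      ∑ μ : Fin ν, (K (0 : TorusSite ν L) (Pi.single μ 1) +
        K (0 : TorusSite ν L) (-Pi.single μ 1)) := by
    intro x
    refine Finset.sum_congr rfl fun μ _ => ?_
    have h1 : K x (x + Pi.single μ 1) = K 0 (Pi.single μ 1) := by
      rw [← hT' 0 (Pi.single μ 1) x, zero_add, add_comm (Pi.single μ 1) x]
    have h2 : K x (x - Pi.single μ 1) = K 0 (-Pi.single μ 1) := by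
      rw [← hT' 0 (-Pi.single μ 1) x, zero_add, neg_add_eq_sub]
    rw [h1, h2]
  have hcard : (Fintype.card (TorusSite ν L) : ℝ) = (L : ℝ) ^ ν := by
    rw [Literature.Probability.LatticeModels.card_torusSite]; push_cast; rfl
  have hLpos : (0 : ℝ) < (L : ℝ) ^ ν := by
    have : (0 : ℝ) < L := Nat.cast_pos.mpr (Nat.pos_of_ne_zero (NeZero.ne L))
    positivity
  simp_rw [hnn]
  rw [Finset.sum_const, Finset.card_univ, nsmul_eq_mul, hcard, ← mul_assoc,
    inv_mul_cancel₀ hLpos.ne', one_mul]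
  rw [hcard] at h
  have hcalc : 2 * (ν : ℝ) / (L : ℝ) ^ ν *
      ((∑ z : TorusSite ν L, K 0 z) - -∑ z : TorusSite ν L, K 0 z) =
      4 * ν * (((L : ℝ) ^ ν)⁻¹ * ∑ x : TorusSite ν L, K 0 x) := by
    field_simp
    ring
  rw [hcalc] at h
  exact h

end Summit.QuantumFields.QCD.Theorems.SmallBetaInfraredSplit
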